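import Summits.HodgeConjecture.CorCM.HypDel.MumfordModuliReceptacle
import Literature.AlgebraicGeometry.ModuliOfAbelianVarieties.SiegelAdelicMarkingHoms
import Literature.AlgebraicGeometry.ModuliOfAbelianVarieties.SiegelAdelicCongrTransport
import Literature.AlgebraicGeometry.ModuliOfAbelianVarieties.SiegelCMLatticeSandwichCompleted
import Literature.AlgebraicGeometry.ModuliOfAbelianVarieties.SiegelCMSpecialPairPeriodIso
import Literature.AlgebraicGeometry.ModuliOfAbelianVarieties.SiegelCanonicalReciprocityBaseField
import Literature.AlgebraicGeometry.Motives.AbelianVarietyHomDivisionOnPoints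
import Literature.NumberTheory.Adeles.FiniteAdeleLatticeOfGLDecomposition
import Summits.HodgeConjecture.HodgeConjecture.Theorems.HCCMUnconditionalShimuraThm18_6Holds
import HarnessLib

/-! ## ROUTE ξ′ ASSEMBLY — would-be `Summits/HodgeConjecture/HodgeConjecture/Theorems/MumfordRouteXiAssembly.lean` (B-p09 g5)

The CM core of the Mumford line under crux HDel (stmt-HodgeConjecture-24835): the receptacle's second-layer Props
(α∀) `CMAdaptedMarkingsAll` (PROVED here: `cmAdaptedMarkingsAll_holds`) and (β) `CompletedSandwich` (stub; B-p21 R60-53) imply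
(C∀) `CMConjugationIsogenyAll` and (C) `CMConjugationIsogeny` — A-p06's CENSUS-M3a route ξ′ composed in Lean: principal neighbours
(★ row II-2), torus maps down (α↓), [Shimura1998] Thm. 18.6 WITH ITS `ξ′` (★ R60-34b over ★ row II-1 `shimura1998_thm18_6_holds`), torus maps
up (α↑), the finite sum `Σᵢ χᵢ^σ ≫ θᵢ` (★ R60-44, ★ `conjPoints_map`), division by the sandwich scalar (★ R60-44), and the coarse
`IsModuli` clause through rational approximation (★ R60-58 `exists_adelicCongr_right`).  HC_CM is proved only modulo the 7 printed citations until rung 0 closes. -/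

-- mandated namespace `Summit.HodgeConjecture.HodgeConjecture.Theorems` trips `linter.dupNamespace` (single-problem summit); off as in
-- `HCCMUnconditionalShimuraThm18_6Holds.lean`.
set_option linter.dupNamespace false

noncomputable section

open scoped Classical nonZeroDivisors NumberField
open Matrix NumberField IsDedekindDomain CategoryTheory Function

namespace Summit.HodgeConjecture.HodgeConjecture.Theorems

namespace MumfordRouteXi

open Literature.AlgebraicGeometry.ModuliOfAbelianVarieties
open Summit.HodgeConjecture.CorCM.HypDel.MumfordModuli

open Literature.Geometry.Kaehler (ComplexTorus)
open Literature.AlgebraicGeometry.Motives (AbelianVariety AlgPoints CMType)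
open Literature.AlgebraicGeometry.Motives.AbelianVariety (map_hom_finset_sum exists_map_eq_of_map_eq_nsmul)
open Literature.NumberTheory.ComplexMultiplication (traceField CMTypeUniformization reflexNormFiniteIdele ideleMulIdealUnits
  shimura1998_thm18_6 shimura1998_thm18_6_family_reflexNormFiniteIdele)
open Literature.NumberTheory.NumberFields.IdeleAction (ideleMulIdeal ideleMulEquiv)
open Literature.NumberTheory.Adeles (latticeOfGL mem_latticeOfGL_iff mem_integralAdeles_iff_mem_integralFiniteAdeles)
open Literature.NumberTheory.Automorphic (integralFiniteAdeles)
open Literature.AlgebraicGeometry.ShimuraVarieties (UnitaryCanonicalModel.IsArtinCorrespondent)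

variable {g : ℕ} {δ : Fin g → ℕ}

/-! ### §0. Adelic-congruence bookkeeping (generic, no CM): the `hker` input and «same left ⇒ same torsion point» -/

/-- Two congruences with the same left-hand side differ by a lattice vector on the right:
`b·v̂ ≡ b′·ŵ` and `b·v̂ ≡ b′·ŵ′ (mod ẑ^{2g})` ⇒ `b′·(ŵ′ − ŵ) ∈ ẑ^{2g}`. [folklore] -/
theorem adelicCongr_right_sub {b b' : GL (Fin g ⊕ Fin g) finAdeleQ} {v w w' : Fin g ⊕ Fin g → ℚ}
    (h : AdelicCongr b b' v w) (h' : AdelicCongr b b' v w') (i : Fin g ⊕ Fin g) :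
    ((b' : Matrix (Fin g ⊕ Fin g) (Fin g ⊕ Fin g) finAdeleQ) *ᵥ adelicVec (w' - w)) i ∈
      FiniteAdeleRing.integralAdeles (𝓞 ℚ) ℚ := by
  have hsub := sub_mem (h i) (h' i)
  rw [adelicVec_sub, mulVec_sub]
  have heq : ((b : Matrix (Fin g ⊕ Fin g) (Fin g ⊕ Fin g) finAdeleQ) *ᵥ adelicVec v -
        (b' : Matrix (Fin g ⊕ Fin g) (Fin g ⊕ Fin g) finAdeleQ) *ᵥ adelicVec w) i -
      ((b : Matrix (Fin g ⊕ Fin g) (Fin g ⊕ Fin g) finAdeleQ) *ᵥ adelicVec v -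
        (b' : Matrix (Fin g ⊕ Fin g) (Fin g ⊕ Fin g) finAdeleQ) *ᵥ adelicVec w') i =
      ((b' : Matrix (Fin g ⊕ Fin g) (Fin g ⊕ Fin g) finAdeleQ) *ᵥ adelicVec w' -
        (b' : Matrix (Fin g ⊕ Fin g) (Fin g ⊕ Fin g) finAdeleQ) *ᵥ adelicVec w) i := by
    simp only [Pi.sub_apply]; ring
  rw [heq] at hsub
  exact hsub

/-- **«Same left ⇒ same torsion point»**: if `w` and `w′` are both congruent to `b·v̂` modulo `a′·ẑ^{2g}` (`b′ = a′⁻¹`), the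
marking `m′` of `[J, a′]` gives them the same point: `u′(w) = u′(w′)` (T1′ `r_eq_of_forall_mem`).
[cite: Milne2005ShimuraVarieties, §6 Thm. 6.11 p. 74] -/
theorem r_eq_of_adelicCongr_of_adelicCongr {J : C0pm δ} {a' : gspFinAdelic δ} {A' : AbelianVariety ℂ}
    (m' : SiegelAdelicMarking J a' A') {b : GL (Fin g ⊕ Fin g) finAdeleQ} {v w w' : Fin g ⊕ Fin g → ℚ}
    (h : AdelicCongr b ((a'⁻¹ : gspFinAdelic δ) : GL (Fin g ⊕ Fin g) finAdeleQ) v w)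
    (h' : AdelicCongr b ((a'⁻¹ : gspFinAdelic δ) : GL (Fin g ⊕ Fin g) finAdeleQ) v w') : m'.r w = m'.r w' := by
  refine (m'.r_eq_of_forall_mem ?_).symm
  exact adelicCongr_right_sub h h'

/-- **The `hker` bookkeeping**: if `v ∈ Λ_a` then `a⁻¹v̂ ≡ (a′)⁻¹ŵ (mod ẑ^{2g})` forces `w ∈ Λ_{a′}` (`a⁻¹v̂ ∈ ẑ^{2g}`, so
`a′⁻¹ŵ ∈ ẑ^{2g}`). [cite: Milne2005ShimuraVarieties, §4 pp. 48–49] -/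
theorem mem_latticeOfGL_of_adelicCongr_of_mem {a a' : gspFinAdelic δ} {v w : Fin g ⊕ Fin g → ℚ}
    (hv : v ∈ latticeOfGL (a : GL (Fin g ⊕ Fin g) finAdeleQ))
    (h : AdelicCongr ((1 * a⁻¹ : gspFinAdelic δ) : GL (Fin g ⊕ Fin g) finAdeleQ)
      ((a'⁻¹ : gspFinAdelic δ) : GL (Fin g ⊕ Fin g) finAdeleQ) v w) :
    w ∈ latticeOfGL (a' : GL (Fin g ⊕ Fin g) finAdeleQ) := by
  rw [mem_latticeOfGL_iff] at hv ⊢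
  intro i
  have hvi : ((((1 * a⁻¹ : gspFinAdelic δ) : GL (Fin g ⊕ Fin g) finAdeleQ) :
      Matrix (Fin g ⊕ Fin g) (Fin g ⊕ Fin g) finAdeleQ) *ᵥ adelicVec v) i ∈ FiniteAdeleRing.integralAdeles (𝓞 ℚ) ℚ := by
    rw [one_mul, Subgroup.coe_inv, mem_integralAdeles_iff_mem_integralFiniteAdeles]
    exact hv i
  have hwi := sub_mem hvi (h i)
  rw [Pi.sub_apply, sub_sub_cancel, Subgroup.coe_inv, mem_integralAdeles_iff_mem_integralFiniteAdeles] at hwi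
  exact hwi

/-- `u′` of a finite sum is the product (T1′ `r_add`, `r_zero`). [cite: Milne2005ShimuraVarieties, §6 Thm. 6.11 p. 74] -/
theorem r_finset_sum {J : C0pm δ} {a : gspFinAdelic δ} {A : AbelianVariety ℂ} (m : SiegelAdelicMarking J a A)
    {I : Type} (s : Finset I) (v : I → Fin g ⊕ Fin g → ℚ) : m.r (∑ i ∈ s, v i) = ∏ i ∈ s, m.r (v i) := by
  classical
  induction s using Finset.induction_on with
  | empty => rw [Finset.sum_empty, Finset.prod_empty, m.r_zero]
  | insert i s hi ih => rw [Finset.sum_insert hi, Finset.prod_insert hi, m.r_add, ih]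

/-! ### §1. THE JUNCTION — stub (C) closed from the named α/β inputs and ★ -/

section Core

variable {ι : Type} [Fintype ι] [DecidableEq ι] {K : ι → Type} [∀ i, Field (K i)] [∀ i, NumberField (K i)]
  [∀ i, IsCMField (K i)]

/-- A composite of homomorphisms acts as the composite on points. [cite: MumfordAV1970, §4] -/
private theorem map_hom_comp' {k : Type} [Field k] {A B C : AbelianVariety k} {L : Type} [Field L] [Algebra k L]
    (u : A ⟶ B) (v : B ⟶ C) (P : A.Points L) :
    AlgPoints.map (u ≫ v).hom.hom.hom P = AlgPoints.map v.hom.hom.hom (AlgPoints.map u.hom.hom.hom P) :=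
  AlgPoints.map_comp_apply u.hom.hom.hom v.hom.hom.hom P

/-- **ROUTE ξ′, CORE (all data explicit).**  At a point `[J, a]` marked by `m` (on `A`) and `[J, r·a]` marked by `m′` (on `A′`),
with `r = R(N)`, `N = (N_{E,Φᵢ}(s))ᵢ` the reciprocity element, a cyclic vector `v₀` (`q x = act(x)·v₀`), a sandwich
`M·⊕𝔟ᵢ ⊆ q⁻¹Λ_a ⊆ ⊕𝔟ᵢ` given through its two USES — (α↓) torus maps `χ : A ⟶ A₁` onto every principal `(Kᵢ,Φᵢ,𝔟ᵢ)`-structure with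
`χ(u(q x)) = ξ.r(xᵢ)`, (α↑) torus maps `θ : A₁ ⟶ A′` from every principal structure of type `(Kᵢ,Φᵢ,𝔞₁)` whose lattice satisfies
`q(eᵢ(M·𝔞₁)) ⊆ Λ_{ra}`, with `θ(ξ₁.r y) = u′(q(eᵢ(M y)))` — and (β↑) `q(eᵢ(M·Nᵢ𝔟ᵢ)) ⊆ Λ_{ra}`, (β≡) the clause form
«`Nᵢ·(xᵢ mod 𝔟ᵢ) = yᵢ mod Nᵢ𝔟ᵢ` for all `i` ⇒ `a⁻¹·q(Mx)^ ≡ (ra)⁻¹·q(My)^`», (A1) every `v` has a congruent partner `w`: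
THERE IS `f : σA ⟶ A′` with `f((u v)^σ) = u′(w)` whenever `a⁻¹v̂ ≡ (ra)⁻¹ŵ (mod ẑ^{2g})`.  Proof = CENSUS-M3a §2: principal
structures (★ `nonempty_of_type`), `χᵢ` (α↓), Thm. 18.6 with `ξ′ᵢ` (★ R60-34b, `h186`), `θᵢ` (α↑ at `ξ′ᵢ`, lattice condition β↑),
`f₀ := Σᵢ χᵢ^σ ≫ θᵢ` (★ `map_hom_finset_sum`, ★ `conjPoints_map`), `f₀((u(qx))^σ) = u′(q(M y))` (β≡ + u′ additive), ÷`M`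
(★ R60-44 `exists_map_eq_of_map_eq_nsmul` with `P x = (u(q x))^σ`, `Q x = u′(w_x)`, `htors` by T1′ v6 `exists_r_eq_of_mem_torsionPoints`,
`hker` by §0). [cite: Milne2005ShimuraVarieties, §11 Thm. 11.2 p. 108; §14 Prop. 14.12 p. 125] [cite: Shimura1998, §18.6 Thm. 18.6 pp. 124–125]
[cite: Deligne1971TravauxShimura, 4.19–4.21 pp. 151–152] -/
theorem exists_hom_conjugate_of_inputs (h186 : shimura1998_thm18_6)
    (c : CMStructure g δ ι K) (J : C0pm δ) (Φ : ∀ i, CMType (K i)) [∀ i, NumberField ↥(traceField (Φ i))]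
    (E : IntermediateField ℚ ℂ) [NumberField ↥E] (hE : ∀ i, traceField (Φ i) ≤ E)
    (σ : ℂ ≃ₐ[↥E] ℂ) (s : (FiniteAdeleRing (𝓞 ↥E) ↥E)ˣ)
    (hs : UnitaryCanonicalModel.IsArtinCorrespondent ↥E (algebraMap ↥E ℂ) s σ.toRingEquiv)
    (r a : gspFinAdelic δ) (A A' : AbelianVariety ℂ) (m : SiegelAdelicMarking J a A) (m' : SiegelAdelicMarking J (r * a) A')
    (v₀ : Fin g ⊕ Fin g → ℚ) (hv₀ : Bijective fun x : Π i, K i => c.act x v₀)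
    (𝔟 : ∀ i, (FractionalIdeal (𝓞 (K i))⁰ (K i))ˣ) (M : ℕ) (hM : M ≠ 0)
    -- (α↓) torus maps DOWN onto the principal neighbours (M3a-α; uses `q⁻¹Λ_a ⊆ ⊕𝔟ᵢ`)
    (hχ : ∀ (i : ι) (A₁ : AbelianVariety ℂ) (ι₁ : 𝓞 (K i) →+* End A₁) (ξ : CMTypeUniformization (Φ i) (𝔟 i) A₁ ι₁),
      ∃ χ : A ⟶ A₁, ∀ x : Π i, K i, AlgPoints.map χ.hom.hom.hom (m.r (c.act x v₀)) = ξ.r (x i))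
    -- (α↑) torus maps UP from any principal structure whose lattice lands in `Λ_{ra}` after `eᵢ ∘ (M·)` (M3a-α)
    (hθ : ∀ (i : ι) (𝔞₁ : (FractionalIdeal (𝓞 (K i))⁰ (K i))ˣ) (A₁ : AbelianVariety ℂ) (ι₁ : 𝓞 (K i) →+* End A₁)
      (ξ₁ : CMTypeUniformization (Φ i) 𝔞₁ A₁ ι₁),
      (∀ y : K i, y ∈ (𝔞₁ : FractionalIdeal (𝓞 (K i))⁰ (K i)) →
          c.act (Pi.single i (M • y)) v₀ ∈ latticeOfGL ((r * a : gspFinAdelic δ) : GL (Fin g ⊕ Fin g) finAdeleQ)) →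
        ∃ θ : A₁ ⟶ A', ∀ y : K i, AlgPoints.map θ.hom.hom.hom (ξ₁.r y) = m'.r (c.act (Pi.single i (M • y)) v₀))
    -- (β↑) the completed sandwich, lattice form: `q(eᵢ(M·Nᵢ𝔟ᵢ)) ⊆ Λ_{ra}` (M3a-β)
    (hup : ∀ (i : ι) (y : K i), y ∈ (ideleMulIdealUnits (reflexNormFiniteIdele (K i) (Φ i) E s) (𝔟 i) :
        FractionalIdeal (𝓞 (K i))⁰ (K i)) →
      c.act (Pi.single i (M • y)) v₀ ∈ latticeOfGL ((r * a : gspFinAdelic δ) : GL (Fin g ⊕ Fin g) finAdeleQ))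
    -- (β≡) the completed sandwich, clause form (M3a-β: ★ R60-43/R60-14c junction)
    (hclause : ∀ x y : Π i, K i,
      (∀ i, ideleMulEquiv (reflexNormFiniteIdele (K i) (Φ i) E s) (𝔟 i : FractionalIdeal (𝓞 (K i))⁰ (K i)) (𝔟 i).ne_zero
          (Submodule.Quotient.mk (x i)) = Submodule.Quotient.mk (y i)) →
        AdelicCongr ((1 * a⁻¹ : gspFinAdelic δ) : GL (Fin g ⊕ Fin g) finAdeleQ)
          (((r * a)⁻¹ : gspFinAdelic δ) : GL (Fin g ⊕ Fin g) finAdeleQ) (c.act (M • x) v₀) (c.act (M • y) v₀))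
    -- (A1) rational approximation: every `v` has a partner `w` (strong approximation for `𝔾_a`; M3a-β)
    (happrox : ∀ v : Fin g ⊕ Fin g → ℚ, ∃ w : Fin g ⊕ Fin g → ℚ,
      AdelicCongr ((1 * a⁻¹ : gspFinAdelic δ) : GL (Fin g ⊕ Fin g) finAdeleQ)
        (((r * a)⁻¹ : gspFinAdelic δ) : GL (Fin g ⊕ Fin g) finAdeleQ) v w) :
    ∃ f : A.conjugate (σ.restrictScalars ℚ).toRingEquiv ⟶ A',
      ∀ v w : Fin g ⊕ Fin g → ℚ,
        AdelicCongr ((1 * a⁻¹ : gspFinAdelic δ) : GL (Fin g ⊕ Fin g) finAdeleQ)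
            (((r * a)⁻¹ : gspFinAdelic δ) : GL (Fin g ⊕ Fin g) finAdeleQ) v w →
          AlgPoints.map f.hom.hom.hom (A.conjPoints (σ.restrictScalars ℚ).toRingEquiv (m.r v)) = m'.r w := by
  -- `σ.restrictScalars ℚ` and `σ` have the same underlying ring automorphism
  have hσ : (σ.restrictScalars ℚ).toRingEquiv = σ.toRingEquiv := rfl
  rw [hσ]
  -- the reciprocity idèle tuple
  set N : ∀ i, (FiniteAdeleRing (𝓞 (K i)) (K i))ˣ := fun i => reflexNormFiniteIdele (K i) (Φ i) E s with hN
  -- STEP 0: principal structures `(Aᵢ, ιᵢ, ξᵢ)` of type `(Kᵢ, Φᵢ, 𝔟ᵢ)` (★ row II-2 `nonempty_of_type`)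
  have hex : ∀ i, ∃ (A₁ : AbelianVariety ℂ) (ι₁ : 𝓞 (K i) →+* End A₁), Nonempty (CMTypeUniformization (Φ i) (𝔟 i) A₁ ι₁) :=
    fun i => CMTypeUniformization.nonempty_of_type (Φ i) (𝔟 i)
  choose B ιB hξ using hex
  have ξ : ∀ i, CMTypeUniformization (Φ i) (𝔟 i) (B i) (ιB i) := fun i => Classical.choice (hξ i)
  -- STEP χ: torus maps down (α↓)
  choose χ hχ' using fun i => hχ i (B i) (ιB i) (ξ i)
  -- STEP 18.6: Shimura's theorem WITH ITS ξ′ at the principal structures, reflex-norm currency (★ R60-34b)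
  obtain ⟨ξ', hξ'⟩ := shimura1998_thm18_6_family_reflexNormFiniteIdele h186 K Φ E hE 𝔟 B ιB ξ σ s hs
  -- STEP θ: torus maps up at `ξ′ᵢ` (α↑), lattice condition (β↑)
  choose θ hθ' using fun i =>
    hθ i (ideleMulIdealUnits (N i) (𝔟 i)) ((B i).conjugate σ.toRingEquiv) (((B i).endConjugate σ.toRingEquiv).comp (ιB i))
      (ξ' i) (hup i)
  -- STEP Σ: `f₀ := Σᵢ χᵢ^σ ≫ θᵢ`
  let f₀ : A.conjugate σ.toRingEquiv ⟶ A' := ∑ i, AbelianVariety.Hom.conjugate σ.toRingEquiv (χ i) ≫ θ i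
  -- the key identity: `f₀((u(q x))^σ) = u′(q(M•y))` whenever `Nᵢ(xᵢ mod 𝔟ᵢ) = yᵢ mod Nᵢ𝔟ᵢ` for all `i`
  have key : ∀ x y : Π i, K i,
      (∀ i, ideleMulEquiv (N i) (𝔟 i : FractionalIdeal (𝓞 (K i))⁰ (K i)) (𝔟 i).ne_zero (Submodule.Quotient.mk (x i)) =
        Submodule.Quotient.mk (y i)) →
      AlgPoints.map f₀.hom.hom.hom (A.conjPoints σ.toRingEquiv (m.r (c.act x v₀))) = m'.r (c.act (M • y) v₀) := by
    intro x y hxy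
    have hfac : ∀ i, AlgPoints.map (AbelianVariety.Hom.conjugate σ.toRingEquiv (χ i) ≫ θ i).hom.hom.hom
        (A.conjPoints σ.toRingEquiv (m.r (c.act x v₀))) = m'.r (c.act (Pi.single i (M • y i)) v₀) := by
      intro i
      rw [map_hom_comp', ← AbelianVariety.conjPoints_map, hχ' i x, hξ' i (x i) (y i) (hxy i), hθ' i (y i)]
    change AlgPoints.map (∑ i, AbelianVariety.Hom.conjugate σ.toRingEquiv (χ i) ≫ θ i).hom.hom.hom _ = _
    rw [map_hom_finset_sum]
    simp_rw [hfac]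
    rw [← r_finset_sum m']
    congr 1
    have hsum : (∑ i, c.act (Pi.single i (M • y i)) v₀) = c.act (∑ i, Pi.single i (M • y i)) v₀ := by
      rw [map_sum, LinearMap.coe_sum, Finset.sum_apply]
    rw [hsum, Finset.univ_sum_single]
    rfl
  -- STEP ÷M, inputs
  -- the partner function `w`
  choose wf hwf using happrox
  -- `P x := (u(q x))^σ`, `Q x := u′(w (q x))`
  have hdiv : ∀ x : Π i, K i, ∃ y : Π i, K i, M • y = x := fun x =>
    ⟨((M : ℚ)⁻¹) • x, by
      rw [← Nat.cast_smul_eq_nsmul ℚ, smul_smul, mul_inv_cancel₀ (Nat.cast_ne_zero.2 hM), one_smul]⟩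
  have hP : ∀ x y : Π i, K i, A.conjPoints σ.toRingEquiv (m.r (c.act (x + y) v₀)) =
      A.conjPoints σ.toRingEquiv (m.r (c.act x v₀)) * A.conjPoints σ.toRingEquiv (m.r (c.act y v₀)) := by
    intro x y
    rw [map_add, LinearMap.add_apply, m.r_add, map_mul]
  have htors : ∀ T ∈ (A.conjugate σ.toRingEquiv).torsionPoints ℂ (M : ℤ),
      ∃ x : Π i, K i, A.conjPoints σ.toRingEquiv (m.r (c.act x v₀)) = T := by
    intro T hT
    obtain ⟨T₀, rfl⟩ := (A.conjPoints σ.toRingEquiv).surjective T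
    rw [AbelianVariety.conjPoints_mem_torsionPoints_iff] at hT
    obtain ⟨v, hv⟩ := m.exists_r_eq_of_mem_torsionPoints hM hT
    obtain ⟨x, rfl⟩ := hv₀.2 v
    exact ⟨x, by rw [hv]⟩
  have hker : ∀ x : Π i, K i, A.conjPoints σ.toRingEquiv (m.r (c.act x v₀)) = 1 → m'.r (wf (c.act x v₀)) = 1 := by
    intro x hx
    rw [MulEquiv.map_eq_one_iff, m.r_eq_one_iff_mem_latticeOfGL] at hx
    exact (m'.r_eq_one_iff_mem_latticeOfGL _).2 (mem_latticeOfGL_of_adelicCongr_of_mem hx (hwf (c.act x v₀)))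
  have hφ : ∀ x : Π i, K i, AlgPoints.map f₀.hom.hom.hom (A.conjPoints σ.toRingEquiv (m.r (c.act x v₀))) =
      m'.r (wf (c.act (M • x) v₀)) := by
    intro x
    -- a partner `y` for the (18.3a) clauses, factor by factor
    have hy : ∀ i, ∃ y : K i, ideleMulEquiv (N i) (𝔟 i : FractionalIdeal (𝓞 (K i))⁰ (K i)) (𝔟 i).ne_zero
        (Submodule.Quotient.mk (x i)) = Submodule.Quotient.mk y :=
      fun i => (Submodule.Quotient.mk_surjective _ _).imp fun _ h => h.symm
    choose y hy' using hy
    rw [key x y hy']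
    -- both `q(M•y)` and `w(q(M•x))` are congruent to `(1·a⁻¹)·q(M•x)^`
    exact r_eq_of_adelicCongr_of_adelicCongr m' (hclause x y hy') (hwf (c.act (M • x) v₀))
  -- STEP ÷M
  obtain ⟨f, hf⟩ := exists_map_eq_of_map_eq_nsmul ℂ M (Nat.cast_ne_zero.2 hM) hdiv
    (fun x : Π i, K i => A.conjPoints σ.toRingEquiv (m.r (c.act x v₀))) hP
    (fun x : Π i, K i => m'.r (wf (c.act x v₀))) htors hker f₀ hφ
  -- conclusion: pass from `F` to `V` through the cyclic vector and from `w_x` to any partner `w`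
  refine ⟨f, fun v w hvw => ?_⟩
  obtain ⟨x, rfl⟩ := hv₀.2 v
  rw [hf x]
  exact r_eq_of_adelicCongr_of_adelicCongr m' (hwf (c.act x v₀)) hvw

end Core

/-! ### §2. THE INPUT PROPS (= the work orders INSIDE stub (C)) and the HEAD: B-plan1's `CMConjugationIsogeny` VERBATIM -/

/-- **THE JUNCTION CERTIFICATE: ROUTE ξ′ closes stub (C)** — `CMConjugationIsogeny` follows from (α) + (β) + (A1) and row II-1
(`h186 : shimura1998_thm18_6`, discharged at any Summits consumer by ★ `Theorems.shimura1998_thm18_6_holds`), through the cyclic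
vector carried by (α), ★ R60-2 `finiteDimensional_traceField` (`E*(Φᵢ)` number fields) and the core
`exists_hom_conjugate_of_inputs`; (A1) = ★ R60-58 `exists_adelicCongr_right`.  Nothing else is used: in particular NOT ★ R60-28/28b/37/37b (isogeny form), NOT R60-24b (`⨁`),
NOT kernel factorisation, NOT `(B′^{σ⁻¹})^σ ≅ B′`; `c.IsSpecial J Φ` enters ONLY through (α).
[cite: Milne2005ShimuraVarieties, §11 Thm. 11.2 p. 108; §14 Prop. 14.12 p. 125] [cite: Shimura1998, §18.6 Thm. 18.6 pp. 124–125] -/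
theorem cmConjugationIsogeny_of_leaves (h186 : shimura1998_thm18_6) (hα : CMAdaptedMarkings) (hβ : CompletedSandwich) :
    CMConjugationIsogeny := by
  intro g δ _ _ ι _ _ K _ _ _ c J Φ hsp E _ hE
  haveI : NumberField ↥E := NumberField.mk
  intro σ s hs r hr a
  haveI : ∀ i, FiniteDimensional ℚ ↥(traceField (Φ i)) := fun i => finiteDimensional_traceField (Φ i)
  haveI : ∀ i, NumberField ↥(traceField (Φ i)) := fun i => NumberField.mk
  -- the cyclic vector of (α) and the CM-adapted marked models at `[J, a]` and `[J, r·a]`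
  obtain ⟨v₀, hv₀, hαv⟩ := hα g δ ι K c J Φ hsp
  obtain ⟨A, m, hχA, -⟩ := hαv a
  obtain ⟨A', m', -, hθA'⟩ := hαv (r * a)
  -- the completed sandwich at `(s, r, a)` (β)
  obtain ⟨𝔟, M, hM, hdown, hup, hclause⟩ := hβ g δ ι K c Φ v₀ hv₀ E s r hr a
  -- the core
  obtain ⟨f, hf⟩ := exists_hom_conjugate_of_inputs h186 c J Φ E hE σ s hs r a A A' m m' v₀ hv₀ 𝔟 M hM
    (fun i A₁ ι₁ ξ => hχA i (𝔟 i) A₁ ι₁ ξ fun x hx => hdown x hx i)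
    (fun i 𝔞₁ A₁ ι₁ ξ₁ hlat => hθA' i M 𝔞₁ A₁ ι₁ ξ₁ hlat) hup hclause (fun v => exists_adelicCongr_right _ _ v)
  exact ⟨A, A', m, m', f, hf⟩

/-! ### §3. The ∀-MARKINGS form (B-plan1 19:20:41Z (3): «state your target as the body of `CMConjugationIsogenyAll` VERBATIM») -/

/-- **THE JUNCTION IN B-plan1's REQUESTED SHAPE: (α∀) + (β) + row II-1 ⇒ (C∀)** — plugs into the skeleton's
`cmConjugationIsogeny_of_all` / `isCanonical_of_isModuli` with zero glue.  GAPS LIST = {`CMAdaptedMarkingsAll` (or `CMAdaptedMarkings`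
+ the already-closed `MarkingTransport`), `CompletedSandwich`}; by name: ★ R60-14, ★ R60-2, ★ `nonempty_of_type`, ★ R60-34b, ★ `conjPoints_map`,
★ R60-44, ★ T1′ γ-API; (A1) = ★ R60-58 `exists_adelicCongr_right`. [cite: Milne2005ShimuraVarieties, §11 Thm. 11.2 p. 108; §14 Prop. 14.12 p. 125]
[cite: Shimura1998, §18.6 Thm. 18.6 pp. 124–125] [cite: Deligne1971TravauxShimura, 4.19–4.21 pp. 151–152] -/
theorem cmConjugationIsogenyAll_of_leaves (h186 : shimura1998_thm18_6) (hα : CMAdaptedMarkingsAll) (hβ : CompletedSandwich) :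
    CMConjugationIsogenyAll := by
  intro g δ _ _ ι _ _ K _ _ _ c J Φ hsp E _ hE
  haveI : NumberField ↥E := NumberField.mk
  intro σ s hs r hr a A A' m m'
  haveI : ∀ i, FiniteDimensional ℚ ↥(traceField (Φ i)) := fun i => finiteDimensional_traceField (Φ i)
  haveI : ∀ i, NumberField ↥(traceField (Φ i)) := fun i => NumberField.mk
  obtain ⟨v₀, hv₀, hαv⟩ := hα g δ ι K c J Φ hsp
  obtain ⟨hχA, -⟩ := hαv a A m
  obtain ⟨-, hθA'⟩ := hαv (r * a) A' m'
  obtain ⟨𝔟, M, hM, hdown, hup, hclause⟩ := hβ g δ ι K c Φ v₀ hv₀ E s r hr a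
  exact exists_hom_conjugate_of_inputs h186 c J Φ E hE σ s hs r a A A' m m' v₀ hv₀ 𝔟 M hM
    (fun i A₁ ι₁ ξ => hχA i (𝔟 i) A₁ ι₁ ξ fun x hx => hdown x hx i)
    (fun i 𝔞₁ A₁ ι₁ ξ₁ hlat => hθA' i M 𝔞₁ A₁ ι₁ ξ₁ hlat) hup hclause (fun v => exists_adelicCongr_right _ _ v)

/-- **(U) + (α) + (β) + row II-1 ⇒ (C∀)** — the registered-stubs reading: with B-p01's (U) closed, the second-layer work orders under
stub (C) are exactly (α) (one CM-adapted chart per point) and (β). [cite: Milne2005ShimuraVarieties, §11 Thm. 11.2 p. 108] -/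
theorem cmConjugationIsogenyAll_of_leaves' (h186 : shimura1998_thm18_6) (hU : MarkingTransport) (hα : CMAdaptedMarkings)
    (hβ : CompletedSandwich) : CMConjugationIsogenyAll :=
  cmConjugationIsogenyAll_of_leaves h186 (cmAdaptedMarkingsAll_of hU hα) hβ

/-! ### §4. (α∀) CLOSED over ★ R60-33 `IsSpecial.exists_periodIso` + B-p01 «MARKING HOMS» §6 (over ★ R60-51); the ONE-INPUT head -/

/-- **(α∀) HOLDS**: at a special pair, the period isomorphism `e` of ★ R60-33 (with its cyclic vector `v₀`, `e(J·) = √−1·e`,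
`e(act(x)·v₀) = Ψ(x)`) feeds B-p01's T1′-typed corollaries `SiegelAdelicMarking.exists_hom_map_r_act_eq_r` /
`exists_hom_map_r_eq_r_act_single` of A-p06's ★ R60-51 `SiegelCMTorusMapsOfChart` — for EVERY marking `m` of every point `[J, b]`.
[cite: Deligne1971TravauxShimura, 4.18–4.19 pp. 150–151] [cite: Milne2005ShimuraVarieties, Ex. 12.4 (b) p. 112, §6 Thm. 6.11 p. 74] -/
theorem cmAdaptedMarkingsAll_holds : CMAdaptedMarkingsAll := by
  intro g δ ι _ _ K _ _ _ c J Φ hsp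
  obtain ⟨e, heJ, -, v₀, hv₀, he⟩ := hsp.exists_periodIso
  refine ⟨v₀, hv₀, fun b A m => ⟨fun i 𝔞₁ A₁ ι₁ ξ₁ hlat => ?_, fun i M 𝔞₁ A₁ ι₁ ξ₁ hlat => ?_⟩⟩
  · exact m.exists_hom_map_r_act_eq_r e heJ hv₀ he i ξ₁ fun x hx => hlat x hx
  · obtain ⟨θ, hθ⟩ := m.exists_hom_map_r_eq_r_act_single e heJ he i ξ₁ M fun y hy => by
      rw [← nsmul_eq_mul]; exact hlat y hy
    exact ⟨θ, fun y => by rw [hθ y, nsmul_eq_mul]⟩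

/-- **STUB (C∀) OF THE MUMFORD LINE MODULO ONE INPUT**: `CMConjugationIsogenyAll` (B-plan1 receptacle R1 VERBATIM) follows from row II-1
(`h186 : shimura1998_thm18_6`) and (β) `CompletedSandwich` ALONE — (α∀) is `cmAdaptedMarkingsAll_holds`, (A1) is ★ R60-58 `exists_adelicCongr_right`.
[cite: Milne2005ShimuraVarieties, §11 Thm. 11.2 p. 108; §14 Prop. 14.12 p. 125] [cite: Shimura1998, §18.6 Thm. 18.6 pp. 124–125]
[cite: Deligne1971TravauxShimura, 4.19–4.21 pp. 151–152] -/
theorem cmConjugationIsogenyAll_of_completedSandwich (h186 : shimura1998_thm18_6) (hβ : CompletedSandwich) :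
    CMConjugationIsogenyAll :=
  cmConjugationIsogenyAll_of_leaves h186 cmAdaptedMarkingsAll_holds hβ

/-! ### §5. The heads over ★ row II-1 `shimura1998_thm18_6_holds` (no hypothesis left but the registered second-layer stubs) -/

/-- **B-plan1's `stub_routeXi` placeholder type, proved**: `CMAdaptedMarkingsAll → CompletedSandwich → CMConjugationIsogenyAll`, with the main
theorem of complex multiplication supplied by ★ `shimura1998_thm18_6_holds` (row II-1, fan-B line b2). [cite: Milne2005ShimuraVarieties, §11 Thm. 11.2 p. 108]
[cite: Shimura1998, §18.6 Thm. 18.6 pp. 124–125] -/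
theorem routeXi (hα : CMAdaptedMarkingsAll) (hβ : CompletedSandwich) : CMConjugationIsogenyAll :=
  cmConjugationIsogenyAll_of_leaves shimura1998_thm18_6_holds hα hβ

/-- **(C∀) from (β) alone** ((α∀) = `cmAdaptedMarkingsAll_holds`, II-1 = ★ `shimura1998_thm18_6_holds`).
[cite: Milne2005ShimuraVarieties, §11 Thm. 11.2 p. 108; §14 Prop. 14.12 p. 125] -/
theorem cmConjugationIsogenyAll_of_completedSandwich' (hβ : CompletedSandwich) : CMConjugationIsogenyAll :=
  routeXi cmAdaptedMarkingsAll_holds hβ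

/-- **(C) from (β) alone**, through the receptacle's `cmConjugationIsogeny_of_all` (markings exist at every point).
[cite: Milne2005ShimuraVarieties, §11 Thm. 11.2 p. 108] -/
theorem cmConjugationIsogeny_of_completedSandwich (hβ : CompletedSandwich) : CMConjugationIsogeny :=
  cmConjugationIsogeny_of_all (cmConjugationIsogenyAll_of_completedSandwich' hβ)

/-- **(α) HOLDS** (the ∃-model form): markings exist at every point (T1′ sibling `exists_isLatticeBasis` + `SiegelAdelicMarking.exists`),
and (α∀) supplies the torus maps for whichever one is chosen. [cite: Milne2005ShimuraVarieties, §6 Thm. 6.11 p. 74] -/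
theorem cmAdaptedMarkings_holds : CMAdaptedMarkings := by
  intro g δ ι _ _ K _ _ _ c J Φ hsp
  obtain ⟨v₀, hv₀, hαv⟩ := cmAdaptedMarkingsAll_holds g δ ι K c J Φ hsp
  refine ⟨v₀, hv₀, fun b => ?_⟩
  obtain ⟨γ, hγ⟩ := exists_isLatticeBasis b
  obtain ⟨A, ⟨m⟩⟩ := SiegelAdelicMarking.exists J b γ hγ
  exact ⟨A, m, hαv b A m⟩

/-! ### §6. (β) HOLDS — the completed sandwich, from B-p21's ★-to-be R60-53 `exists_completedSandwich_cmRecip` (spelling bridge only) -/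

/-- **(β) `CompletedSandwich` HOLDS**: B-p21's R60-53 `CMStructure.exists_completedSandwich_cmRecip` (over ★ R60-52 sandwich, ★ R60-50 rational ⇒
adelic, ★ R60-48 transport) IS the receptacle's (β) once `AdelicCongr (1·a⁻¹) ((r·a)⁻¹)` is unfolded (`one_mul`, `Subgroup.coe_inv/coe_mul`,
the two spellings of `ẑ` ★ `mem_integralAdeles_iff_mem_integralFiniteAdeles`) and `ideleMulIdealUnits` is read as `ideleMulIdeal`
(★ `coe_ideleMulIdealUnits`). [cite: Shimura1998, §18.3 (18.3a) p. 122; §6.2 Thm. 3 pp. 41–42] [cite: Milne2005ShimuraVarieties, Def. 12.8 (60)–(62) p. 114] -/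
theorem completedSandwich_holds : CompletedSandwich := by
  intro g δ ι _ _ K _ _ _ c Φ v₀ hv₀ E _ s r hr a
  obtain ⟨𝔟, M, hM, hdown, hup, hclause⟩ :=
    c.exists_completedSandwich_cmRecip hv₀ Φ E s (r := (r : GL (Fin g ⊕ Fin g) finAdeleQ)) (a := (a : GL (Fin g ⊕ Fin g) finAdeleQ)) hr
  refine ⟨𝔟, M, hM, hdown, fun i y hy => ?_, fun x y hxy => ?_⟩
  · rw [Literature.NumberTheory.ComplexMultiplication.coe_ideleMulIdealUnits] at hy
    rw [Subgroup.coe_mul]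
    exact hup i y hy
  · rw [show ((1 * a⁻¹ : gspFinAdelic δ) : GL (Fin g ⊕ Fin g) finAdeleQ) = (a : GL (Fin g ⊕ Fin g) finAdeleQ)⁻¹ by
        rw [one_mul, Subgroup.coe_inv],
      show (((r * a)⁻¹ : gspFinAdelic δ) : GL (Fin g ⊕ Fin g) finAdeleQ) =
          ((r : GL (Fin g ⊕ Fin g) finAdeleQ) * (a : GL (Fin g ⊕ Fin g) finAdeleQ))⁻¹ by
        rw [Subgroup.coe_inv, Subgroup.coe_mul]]
    intro j
    rw [mem_integralAdeles_iff_mem_integralFiniteAdeles]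
    exact hclause x y hxy j

/-- **(C∀) WITH NO HYPOTHESIS LEFT but the tree**: `CMConjugationIsogenyAll` from ★ row II-1, (α∀) `cmAdaptedMarkingsAll_holds` and (β)
`completedSandwich_holds` — i.e. once R60-53 is ★, the CM core of #60 under `hDel` is a theorem and the Mumford line rests on the single FACT
`stub_mumford`. [cite: Milne2005ShimuraVarieties, §11 Thm. 11.2 p. 108; §14 Prop. 14.12 p. 125] [cite: Deligne1971TravauxShimura, 4.19–4.21 pp. 151–152] -/
theorem cmConjugationIsogenyAll_holds : CMConjugationIsogenyAll :=
  routeXi cmAdaptedMarkingsAll_holds completedSandwich_holds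

/-- **(C) WITH NO HYPOTHESIS LEFT but the tree** (= `stub_cmConjugationIsogeny` of edition v4.8 closed).
[cite: Milne2005ShimuraVarieties, §11 Thm. 11.2 p. 108] -/
theorem cmConjugationIsogeny_holds : CMConjugationIsogeny :=
  cmConjugationIsogeny_of_all cmConjugationIsogenyAll_holds

end MumfordRouteXi

end Summit.HodgeConjecture.HodgeConjecture.Theorems

end
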